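import Literature.AlgebraicGeometry.Frobenioids.Thm36SubModelProofs
import Literature.AlgebraicGeometry.Frobenioids.Thm36SubInstancesB
import Literature.AlgebraicGeometry.Frobenioids.ArchimedeanFrobenioidRelative
import HarnessLib

/-!
# Frobenioids II, Thm. 3.6 (i): HEAD-EXACT closers of the typed SCHEMATA `ArchFrd.Thm36i_charSplitting`
# (`Λ = ℝ`) and `ArchFrd.Thm36i_ampleTypes` (`Λ = ℝ`, and all `Λ` at THE completion data) at the archimedean
# Frobenioids of Example 3.3 (D-0079 L-F [FrdI/II], pack A; trunks `ArchimedeanStandardType.lean`,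
# `ArchimedeanBasicProperties.lean`)

Mochizuki, *The geometry of Frobenioids II: poly-Frobenioids*, Kyushu J. Math. **62** (2008) 401–460, §3,
Theorem 3.6 (i), author's kurims text p. 36 [cite: MochizukiFrdII2008, Thm 3.6 (i) p.36].

PROOF-ONLY companion (abc-iut cell, seat abc-iut-L1-t12 gen 7; FACT-LIST rows F-0701 `Thm36i_charSplitting`
(abc-iut-L1-t9's `ArchimedeanStandardType.lean`) and F-0690 `Thm36i_ampleTypes` (`ArchimedeanBasicProperties.lean`);
no statement file is edited).  Both schemata bind their SUBJECT (the structure functor `F`) as a free parameter;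
their universal closures are REFUTED in the tree (`ArchimedeanBasicPropertiesSchemaNegativeE.lean`:
`ArchFrd.not_thm36i_ampleTypes_A`; the characteristic-splitting schema over an arbitrary `radial` predicate).
What print asserts is their value at the archimedean Frobenioids `C^Λ` (`Λ ∈ {ℤ, ℚ, ℝ}`) of Example 3.3.  The
tree PROVES exactly those values, but at `Λ = ℝ` (and for all `Λ` at once) only under instance-definition /
slot heads (`Thm36Sub.charSplitting_R`, `Thm36Sub.ampleTypes_R`, `Thm36i_ampleTypes_C`).  This file states the
HEAD-EXACT forms the L-F ledger folds by name — one-line re-headings, no new mathematics, no definition (the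
`Λ = ℤ` heads `ArchFrd.thm36i_charSplitting_generic_C` (abc-iut-f-015, `ArchimedeanGenericHeadsLF.lean`),
`ArchFrd.thm36i_ampleTypes_C` / `thm36i_ampleTypes_CZ` (`ArchimedeanAmpleness.lean`) and the `Λ = ℚ` heads
`Thm36Sub.charSplitting_Q_holds` (`Thm36SubPerfectionCharSplitting.lean`), `Thm36Sub.thm36i_ampleTypes_instance_Q`
(`Thm36SubAmpleTypesQ.lean`) are already exact in the tree and are NOT restated):

* F-0701: `thm36i_charSplitting_rlf` (`Λ = ℝ` at THE realification `C^rlf`, every base; abc-iut-w4-d074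
  lineage's `Thm36Sub.charSplitting_R_holds`).
* F-0690: `thm36i_ampleTypes_rlf` (`Λ = ℝ` at `C^rlf`, connected base; `Thm36Sub.ampleTypes_R_holds`),
  `thm36i_ampleTypes_completions_of` / `thm36i_ampleTypes_completions` (ALL `Λ` at THE perfection /
  realification data `Thm36Sub.pfCompletion` / `Thm36Sub.rlfCompletion`, for every value of the parameter
  `hF` resp. under print's standing hypotheses "`D` connected, totally epimorphic" of §3 p. 26, discharging `hF`
  by Ex. 3.3 (ii) `ArchFrd.Ex33ii_isFrobenioid_holds`; from `Thm36Sub.thm36i_ampleTypes_C_holds`).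

Honest framing: typed ≠ proved elsewhere; these are OUR kernel checks of OUR typed instance forms of a refereed
paper; nothing here bears on [IUTchIII] Cor. 3.12 and no side is taken.
-/

namespace Literature.AlgebraicGeometry.Frobenioids

open CategoryTheory

namespace ArchFrd

universe v u

variable {D : Type u} [Category.{v} D] (π : D ⥤ D0)

/-! ### F-0701: Thm. 3.6 (i), "characteristic splitting", schema head `Thm36i_charSplitting`, `Λ = ℝ` -/

/-- **[FrdII] Thm. 3.6 (i), characteristic-splitting clause, `Λ = ℝ`, AS TYPED** at THE realification
`C^ℝ = C^rlf` (structure functor `Thm36Sub.rlfStr π`), over EVERY base: the splitting is all of `O^▷(A)`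
(`O^×(A) = {1}` at `Λ = ℝ`, Thm. 3.6 (v) (c)) — `Thm36Sub.charSplitting_R_holds`, whose head is the slot
`Thm36Sub.charSplitting_R`. FACT-LIST F-0701. [cite: MochizukiFrdII2008, Thm 3.6 (i) p.36] -/
theorem thm36i_charSplitting_rlf :
    Literature.AlgebraicGeometry.Frobenioids.ArchFrd.Thm36i_charSplitting (Thm36Sub.rlfStr π)
      (fun A t => t ∈ PreFrobenioid.endSubmonoid (Thm36Sub.rlfStr π) A) :=
  Thm36Sub.charSplitting_R_holds π

/-! ### F-0690: Thm. 3.6 (i), typology clauses, schema head `Thm36i_ampleTypes` -/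

/-- **[FrdII] Thm. 3.6 (i), "`C^Λ` is of `Aut`-ample, `Aut^sub`-ample, `End`-ample and metrically trivial type,
but not of group-like type", `Λ = ℝ`, AS TYPED** (schema `ArchFrd.Thm36i_ampleTypes`) at THE realification
`C^rlf` over every connected base (print's "`D` connected", Ex. 3.3 (i) p. 27, is used for "not group-like":
it supplies an object) — `Thm36Sub.ampleTypes_R_holds`, whose head is the slot `Thm36Sub.ampleTypes_R`.
FACT-LIST F-0690. [cite: MochizukiFrdII2008, Thm 3.6 (i) p.36] -/
theorem thm36i_ampleTypes_rlf (hD : IsGraphConnected D) :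
    Literature.AlgebraicGeometry.Frobenioids.ArchFrd.Thm36i_ampleTypes (Thm36Sub.rlfStr π) :=
  Thm36Sub.ampleTypes_R_holds π hD

/-- **[FrdII] Thm. 3.6 (i), typology clauses, ALL `Λ ∈ {ℤ, ℚ, ℝ}`, AS TYPED** (schema `ArchFrd.Thm36i_ampleTypes`)
at the structure functor of `C^Λ = archFrobenioid π pf rlf Λ` for THE perfection / realification data
`pf := Thm36Sub.pfCompletion π hF`, `rlf := Thm36Sub.rlfCompletion π`, for every value of the construction's
parameter `hF` ("`C` is a Frobenioid", Ex. 3.3 (ii)) — the `Λ`-th conjunct of `Thm36Sub.thm36i_ampleTypes_C_holds`.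
FACT-LIST F-0690 at the consumed instances. [cite: MochizukiFrdII2008, Thm 3.6 (i) p.36] -/
theorem thm36i_ampleTypes_completions_of (hF : PreFrobenioid.IsFrobenioid (C.toElem π)) (Λ : MonoidType) :
    Literature.AlgebraicGeometry.Frobenioids.ArchFrd.Thm36i_ampleTypes
      (archFrobenioid π (Thm36Sub.pfCompletion π hF) (Thm36Sub.rlfCompletion π) Λ).str :=
  Thm36Sub.thm36i_ampleTypes_C_holds π hF Λ

/-- **[FrdII] Thm. 3.6 (i), typology clauses, ALL `Λ`, AS TYPED, under print's OWN standing hypotheses of §3**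
("`D` a connected, totally epimorphic category", p. 26): then `C` is a Frobenioid by Ex. 3.3 (ii)
(`ArchFrd.Ex33ii_isFrobenioid_holds`, abc-iut-L1-t6) and `thm36i_ampleTypes_completions_of` applies at THE
completion data. FACT-LIST F-0690, print-generality form. [cite: MochizukiFrdII2008, Thm 3.6 (i) p.36] -/
theorem thm36i_ampleTypes_completions (hD : IsGraphConnected D) (hTE : IsTotallyEpimorphic D)
    (Λ : MonoidType) :
    Literature.AlgebraicGeometry.Frobenioids.ArchFrd.Thm36i_ampleTypes
      (archFrobenioid π (Thm36Sub.pfCompletion π (Ex33ii_isFrobenioid_holds π hD hTE))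
        (Thm36Sub.rlfCompletion π) Λ).str :=
  thm36i_ampleTypes_completions_of π (Ex33ii_isFrobenioid_holds π hD hTE) Λ

end ArchFrd

end Literature.AlgebraicGeometry.Frobenioids
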